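import Summits.BirchSwinnertonDyer.Rank1Residual.Additive.StrictSignedSelmerDual
import Literature.NumberTheory.EllipticCurves.IwasawaSelmerControlCokerProofs
import HarnessLib

/-!
# Sub-Selmer families at the bottom layer, EXACT form: `ord_p #S₀ + ord_p #(A₀/S₀) = ord_p f(0)`
# with `A₀ = h₀⁻¹(S_∞)` — p17's inequality `ord_p #S₀ ≤ ord_p f(0)` (file SubSelmerControlZero)
# upgraded to an identity whose defect is Greenberg's `ker g₀ ≅ A₀/S₀` (the first brick, B1, of the
# GLOBAL count (C) of the (C3_η) derivation; cell `b2b-bsdres`, CLASS-CLOSURE lane, class O10 — x1b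
# GEN 34, class lead; file 42 of the series)

HONEST FRAMING (cell `b2b-bsdres`, run/shared/lean/b2b/bsd-rank1-residual/, verbatim in every
file): the goal of the cell is to DELETE the COMBINATION-SHAPED residual classes of the
Birch–Swinnerton-Dyer formula for ALL analytic-rank `≤ 1` elliptic curves over `ℚ` — "full BSD
formula for every rank `≤ 1` curve in class `C`" assembled STRICTLY from published theorems — so
that the rank-`≤ 1` remainder becomes exactly the CONSTRUCTION-SHAPED classes, which are TYPED
(missing-input `Prop`s), NOT attempted. This is not "finishing BSD". CLASS-CLOSURE lane: prove
what is provable now; shrink each hard class to its core with data; no claim beyond stated classes;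
research routes on CONSTRUCTION-SHAPED X12 / O10; census / instrument output = EVIDENCE / conjecture
items, NEVER a Literature fact; `RESIDUAL-MAP.md` marks change only by signed lines. THIS FILE:
TOOL THEOREMS ONLY (generic `Λ`-algebra and Galois-cohomology bookkeeping over additive-p4's /
p17's / the tree's objects) — no definition, no named Literature fact, no Summits-side fact
`def … : Prop`, no `sorry`, axioms standard; nothing is booked; no label / mark / count / sub-cell
moves; (C1_η), (C2_η-GZ), (C3_η) stay typed as filed; O10 stays OPEN / CONSTRUCTION-SHAPED; nothing
about `BSD(W, p)` of any pair is claimed.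

## What

p17's `SubSelmerControlZero.finite_and_padicValNat_card_le`: for a `conj_γ`-stable family
`S_∞ ≤ H¹(K_∞, E[p^∞])` with a Pontryagin-dual pair `(S_∞, conj_γ − 1) ↔ X` (`X` f.g. torsion,
`char = (f)`, `f(0) ≠ 0`, no finite submodule) and `S₀ ≤ H¹(K_0, E[p^∞])` restricting into `S_∞`,
`E(K_∞)[p^∞] = 0` ⟹ `ord_p #S₀ ≤ ord_p f(0)`. Here the EQUALITY with its defect:

* §1 (algebra) `finite_and_padicValNat_card_add_eq_of_injective`: for `φ : S₀ ↪ S^{ψ=0}`: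
  `ord_p #S₀ + ord_p #(S^{ψ=0} ⧸ φ(S₀)) = ord_p f(0)` (Greenberg Lemma 4.2 with `X[T] = 0`:
  `f(0) = u · #(X/TX) = u · #S^{ψ=0}`, and Lagrange).
* §2 (Selmer) **`finite_and_padicValNat_card_add_eq`**: with `A₀ := h₀⁻¹(S_∞) = S_∞.comap h₀`
  (`h₀ = layerToInfty κ 0`): **`ord_p #S₀ + ord_p #(A₀ ⧸ S₀) = ord_p f(0)`** — the map
  `A₀ → S_∞^{conj_γ = 1}` is injective (`E(K_∞)[p^∞] = 0`, [K] Lemma 9.1) AND onto: a `conj_γ`-fixed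
  class of `H¹(K_∞, E[p^∞])` is a restriction from `K_0` (Greenberg Lemma 3.2 / `cd_p ℤ_p = 1`, the
  tree's `ZpExtension.mem_range_resOfLe_of_conjH1_eq`). `A₀ ⧸ S₀ ≅ ker g₀` is Greenberg's term
  (`IwasawaSelmerControl`: `selmerInftyPreimage`), to be computed by the local kernels.
* §3 the instance for Kobayashi's STRICT-minus structure in `W`-coordinates
  (`StrictSignedSelmerDualData`, p17): `StrictSignedControlZero.finite_and_padicValNat_card_add_eq`.

References: [GreenbergLNM1716] §3 Lemma 3.1–3.2 (p. 86), §4 Lemma 4.2 (p. 102);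
[Kobayashi2003] Lemma 9.1 (p. 25), Thm. 9.3 (p. 26).
-/

noncomputable section

open scoped Classical

open WeierstrassCurve Literature.NumberTheory.EllipticCurves Literature.NumberTheory.GaloisRepresentations
  Literature.NumberTheory.EllipticCurves.IwasawaAlgebra Literature.NumberTheory.EllipticCurves.IwasawaDual
  ZpExtension

universe u

namespace Summit.BirchSwinnertonDyer.Rank1Residual.Additive

namespace SubSelmerControlZero

/-! ## §1 `Λ`-algebra: the exact count through an injection into the invariants -/

section Algebra

variable (p : ℕ) [Fact p.Prime] {S : Type*} [AddCommGroup S] {ψ : AddMonoid.End S}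
  {X : Type u} [AddCommGroup X] [Module (IwasawaAlgebra p) X] [Module.Finite (IwasawaAlgebra p) X]
  {toDual : X →+ (S →+ AddCircle (1 : ℚ))}

/-- **The bottom-layer identity, algebraic core.** For a Pontryagin-dual pair `(S, ψ) ↔ X` with `X`
finitely generated `Λ`-torsion, `char(X) = (f)`, `f(0) ≠ 0`, NO non-trivial finite `Λ`-submodule, and
an injection `φ : S₀ ↪ S^{ψ=0}`: `S₀` and `S^{ψ=0} ⧸ φ(S₀)` are finite and
**`ord_p #S₀ + ord_p #(S^{ψ=0} ⧸ φ(S₀)) = ord_p f(0)`** (`f(0) = u · #(X/TX)`, `#(X/TX) = #S^{ψ=0}`,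
Lagrange). [cite: GreenbergLNM1716, §4 Lemma 4.2 (p. 102)] -/
theorem finite_and_padicValNat_card_add_eq_of_injective (h : IsDualPair p ψ toDual)
    (hX : Module.IsTorsion (IwasawaAlgebra p) X)
    (hnf : ∀ N : Submodule (IwasawaAlgebra p) X, Finite N → N = ⊥)
    {f : IwasawaAlgebra p} (hf : Module.charIdeal (IwasawaAlgebra p) X = Ideal.span {f})
    (h0 : PowerSeries.constantCoeff f ≠ 0)
    {S₀ : Type*} [AddCommGroup S₀] (φ : S₀ →+ endInvariants ψ) (hφ : Function.Injective φ) :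
    Finite S₀ ∧ Finite (↥(endInvariants ψ) ⧸ φ.range) ∧
      (padicValNat p (Nat.card S₀) : ℤ) + padicValNat p (Nat.card (↥(endInvariants ψ) ⧸ φ.range)) =
        ((PowerSeries.constantCoeff f : ℤ_[p]) : ℚ_[p]).valuation := by
  obtain ⟨hcoinv, u, hu⟩ :=
    SignedControlZero.exists_constantCoeff_eq_unit_mul_natCard_coinvariants p X hX f hf h0 hnf
  have hcardS : Nat.card (coinvariants p X) = Nat.card (endInvariants ψ) := h.natCard_coinvariants
  haveI hSfin : Finite (endInvariants ψ) := h.finite_coinvariants_iff.mp hcoinv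
  -- `#S^{ψ=0} = #(S^{ψ=0}/φ(S₀)) · #φ(S₀)` and `#φ(S₀) = #S₀`
  have hlag : Nat.card (endInvariants ψ) = Nat.card (↥(endInvariants ψ) ⧸ φ.range) * Nat.card φ.range :=
    AddSubgroup.card_eq_card_quotient_mul_card_addSubgroup φ.range
  have hrange : Nat.card φ.range = Nat.card S₀ := (Nat.card_congr (AddMonoidHom.ofInjective hφ).toEquiv).symm
  have hSpos : 0 < Nat.card (endInvariants ψ) := Nat.card_pos
  have hq0 : Nat.card (↥(endInvariants ψ) ⧸ φ.range) ≠ 0 := fun h' => by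
    rw [h', zero_mul] at hlag; exact hSpos.ne' hlag
  have hs0 : Nat.card S₀ ≠ 0 := fun h' => by
    rw [hrange, h', mul_zero] at hlag; exact hSpos.ne' hlag
  haveI hfinS₀ : Finite S₀ := Nat.finite_of_card_ne_zero hs0
  haveI hfinQ : Finite (↥(endInvariants ψ) ⧸ φ.range) := Nat.finite_of_card_ne_zero hq0
  refine ⟨hfinS₀, hfinQ, ?_⟩
  have hval : ((PowerSeries.constantCoeff f : ℤ_[p]) : ℚ_[p]).valuation =
      (padicValNat p (Nat.card (endInvariants ψ)) : ℤ) := by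
    have hcast : ((PowerSeries.constantCoeff f : ℤ_[p]) : ℚ_[p]) =
        ((u : ℤ_[p]) : ℚ_[p]) * ((Nat.card (endInvariants ψ) : ℕ) : ℚ_[p]) := by
      rw [hu, ← hcardS, PadicInt.coe_mul, PadicInt.coe_natCast]
    rw [hcast, Padic.valuation_mul (coe_units_ne_zero p u) (by exact_mod_cast hSpos.ne'),
      valuation_coe_units_eq_zero, zero_add, Padic.valuation_natCast]
  rw [hval, hlag, hrange, padicValNat.mul hq0 hs0]
  push_cast
  ring

end Algebra

/-! ## §2 Sub-Selmer families: `ord_p #S₀ + ord_p #(A₀/S₀) = ord_p f(0)` -/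

section Selmer

variable {K : Type u} [Field K] [NumberField K] (W : WeierstrassCurve K) {p : ℕ} [Fact p.Prime]
  {κ : ZpExtension K p} {γ : Field.absoluteGaloisGroup K}

/-- **`A₀ = h₀⁻¹(S_∞)` maps ONTO the `γ`-invariants of the family.** For `S_∞ ≤ H¹(K_∞, E[p^∞])` with
`ψ = conj_γ − 1` (`γ` a topological generator): every `s ∈ S_∞` with `ψ s = 0` is `h₀ y` for some
`y ∈ H¹(K_0, E[p^∞])` — Greenberg's Lemma 3.2 (`coker h₀ = 0`, `cd_p ℤ_p = 1`; the tree's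
`ZpExtension.mem_range_resOfLe_of_conjH1_eq`), and then `y ∈ A₀`. [cite: GreenbergLNM1716, §3 Lemma 3.2 (p. 86)] -/
theorem exists_layerToInfty_eq_of_mem_endInvariants (hγ : κ.IsTopGenerator γ)
    {Sinf : AddSubgroup (W.subgroupH1 p κ.kerSubgroup)} {ψ : AddMonoid.End Sinf}
    (hψ : ∀ s : Sinf, ((ψ s : Sinf) : W.subgroupH1 p κ.kerSubgroup) =
      W.conjH1 p κ.kerSubgroup γ (s : W.subgroupH1 p κ.kerSubgroup) - s)
    {s : Sinf} (hs : s ∈ endInvariants ψ) :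
    ∃ y ∈ Sinf.comap (W.layerToInfty κ 0), W.layerToInfty κ 0 y = (s : W.subgroupH1 p κ.kerSubgroup) := by
  have hfix : W.conjH1 p κ.kerSubgroup (γ ^ p ^ 0) (s : W.subgroupH1 p κ.kerSubgroup) = s := by
    rw [pow_zero, pow_one]
    have h := hψ s
    rw [(mem_endInvariants_iff ψ s).mp hs, ZeroMemClass.coe_zero, eq_comm, sub_eq_zero] at h
    exact h
  have hprim : ∀ m : geomPrimaryTorsion W p, ∃ k : ℕ, p ^ k • m = 0 := fun m ↦ by
    obtain ⟨k, hk⟩ := m.2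
    exact ⟨k, Subtype.ext (by rw [AddSubgroupClass.coe_nsmul, hk, ZeroMemClass.coe_zero])⟩
  obtain ⟨y, hy⟩ := ZpExtension.mem_range_resOfLe_of_conjH1_eq κ hγ 0 (W.continuous_smul_geomPrimaryTorsion p)
    hprim (s : W.subgroupH1 p κ.kerSubgroup) hfix
  refine ⟨y, ?_, hy⟩
  rw [AddSubgroup.mem_comap]
  change W.resOfLe p (κ.kerSubgroup_le_layerSubgroup 0) y ∈ Sinf
  rw [show W.resOfLe p (κ.kerSubgroup_le_layerSubgroup 0) y = (s : W.subgroupH1 p κ.kerSubgroup) from hy]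
  exact s.2

/-- **The bottom-layer identity for an arbitrary sub-Selmer family.** Let `E/K` be an elliptic
curve over a number field, `κ` a `ℤ_p`-extension with topological generator `γ`,
`S_∞ ≤ H¹(K_∞, E[p^∞])` ANY subgroup with an endomorphism `ψ` acting as `conj_γ − 1`, `(S_∞, ψ) ↔ X`
a Pontryagin-dual pair with `X` finitely generated `Λ`-torsion, `char(X) = (f)`, `f(0) ≠ 0` and NO
non-trivial finite `Λ`-submodule, `S₀ ≤ H¹(K_0, E[p^∞])` ANY subgroup restricting into `S_∞`, and
`A₀ = h₀⁻¹(S_∞)`. If `E(K_∞)[p^∞] = 0`, then `S₀` and `A₀ ⧸ S₀` are finite and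
**`ord_p #S₀ + ord_p #(A₀ ⧸ S₀) = ord_p f(0)`** — `h₀ : A₀ → S_∞^{ψ=0}` is a BIJECTION ([K] Lemma
9.1 / Greenberg 3.1 for injectivity, Greenberg 3.2 for surjectivity). The defect `A₀ ⧸ S₀` is
Greenberg's `ker g₀` (classes over `K` whose restriction to `K_∞` lies in the family, modulo `S₀`).
[cite: GreenbergLNM1716, §3 Lemma 3.1–3.2 (p. 86) and §4 Lemma 4.2 (p. 102)] [cite: Kobayashi2003, Lemma 9.1 (p. 25)] -/
theorem finite_and_padicValNat_card_add_eq (hγ : κ.IsTopGenerator γ)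
    (hB : FixedPoints.addSubgroup κ.kerSubgroup (W.geomPrimaryTorsion p) = ⊥)
    {Sinf : AddSubgroup (W.subgroupH1 p κ.kerSubgroup)} {ψ : AddMonoid.End Sinf}
    (hψ : ∀ s : Sinf, ((ψ s : Sinf) : W.subgroupH1 p κ.kerSubgroup) =
      W.conjH1 p κ.kerSubgroup γ (s : W.subgroupH1 p κ.kerSubgroup) - s)
    {X : Type u} [AddCommGroup X] [Module (IwasawaAlgebra p) X] [Module.Finite (IwasawaAlgebra p) X]
    {toDual : X →+ (Sinf →+ AddCircle (1 : ℚ))} (hpair : IsDualPair p ψ toDual)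
    (hX : Module.IsTorsion (IwasawaAlgebra p) X)
    (hnf : ∀ N : Submodule (IwasawaAlgebra p) X, Finite N → N = ⊥)
    {f : IwasawaAlgebra p} (hf : Module.charIdeal (IwasawaAlgebra p) X = Ideal.span {f})
    (h0 : PowerSeries.constantCoeff f ≠ 0)
    (S₀ : AddSubgroup (W.subgroupH1 p (κ.layerSubgroup 0)))
    (hS₀ : S₀.map (W.layerToInfty κ 0) ≤ Sinf) :
    Finite S₀ ∧
      Finite (↥(Sinf.comap (W.layerToInfty κ 0)) ⧸ S₀.addSubgroupOf (Sinf.comap (W.layerToInfty κ 0))) ∧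
      (padicValNat p (Nat.card S₀) : ℤ) +
          padicValNat p (Nat.card (↥(Sinf.comap (W.layerToInfty κ 0)) ⧸
            S₀.addSubgroupOf (Sinf.comap (W.layerToInfty κ 0)))) =
        ((PowerSeries.constantCoeff f : ℤ_[p]) : ℚ_[p]).valuation := by
  set A₀ := Sinf.comap (W.layerToInfty κ 0) with hA₀
  obtain ⟨φ, hφ, hφval⟩ := exists_injective_toEndInvariants W hγ hB hψ S₀ hS₀
  obtain ⟨hfinS₀, hfinQ, heq⟩ := finite_and_padicValNat_card_add_eq_of_injective p hpair hX hnf hf h0 φ hφ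
  -- `A₀ → S_∞^{ψ=0}`, `y ↦ h₀ y`: a bijection
  have hmemS : ∀ y : A₀, W.layerToInfty κ 0 (y : W.subgroupH1 p (κ.layerSubgroup 0)) ∈ Sinf :=
    fun y ↦ AddSubgroup.mem_comap.mp y.2
  have hfix : ∀ y : A₀, (⟨W.layerToInfty κ 0 (y : W.subgroupH1 p (κ.layerSubgroup 0)), hmemS y⟩ : Sinf) ∈
      endInvariants ψ := by
    intro y
    rw [mem_endInvariants_iff]
    apply Subtype.ext
    rw [hψ, ZeroMemClass.coe_zero, sub_eq_zero]
    have hinv := W.range_layerToInfty_le_layerInvariants_holds κ 0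
      ⟨(y : W.subgroupH1 p (κ.layerSubgroup 0)), rfl⟩
    rw [mem_layerInvariants_iff] at hinv
    exact hinv γ (by rw [ZpExtension.layerSubgroup_zero]; exact Subgroup.mem_top γ)
  let Φ : A₀ → endInvariants ψ := fun y ↦
    ⟨⟨W.layerToInfty κ 0 (y : W.subgroupH1 p (κ.layerSubgroup 0)), hmemS y⟩, hfix y⟩
  have hΦinj : Function.Injective Φ := fun a b hab ↦ by
    have h := congrArg (fun z : endInvariants ψ ↦ ((z : Sinf) : W.subgroupH1 p κ.kerSubgroup)) hab
    exact Subtype.ext (SignedControlZero.layerToInfty_zero_injective W hγ hB h)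
  have hΦsurj : Function.Surjective Φ := by
    rintro ⟨s, hs⟩
    obtain ⟨y, hyA, hy⟩ := exists_layerToInfty_eq_of_mem_endInvariants W hγ hψ hs
    exact ⟨⟨y, hyA⟩, Subtype.ext (Subtype.ext hy)⟩
  have hcardA : Nat.card A₀ = Nat.card (endInvariants ψ) := Nat.card_eq_of_bijective Φ ⟨hΦinj, hΦsurj⟩
  -- Lagrange on both sides
  have hle₀ : S₀ ≤ A₀ := by rw [hA₀, ← AddSubgroup.map_le_iff_le_comap]; exact hS₀
  have hS₀' : Nat.card (S₀.addSubgroupOf A₀) = Nat.card S₀ :=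
    Nat.card_congr (AddSubgroup.addSubgroupOfEquivOfLe hle₀).toEquiv
  have hlagA : Nat.card A₀ = Nat.card (A₀ ⧸ S₀.addSubgroupOf A₀) * Nat.card (S₀.addSubgroupOf A₀) :=
    AddSubgroup.card_eq_card_quotient_mul_card_addSubgroup _
  have hlagE : Nat.card (endInvariants ψ) = Nat.card (↥(endInvariants ψ) ⧸ φ.range) * Nat.card φ.range :=
    AddSubgroup.card_eq_card_quotient_mul_card_addSubgroup φ.range
  have hrange : Nat.card φ.range = Nat.card S₀ := (Nat.card_congr (AddMonoidHom.ofInjective hφ).toEquiv).symm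
  haveI := hfinS₀
  have hs0 : Nat.card S₀ ≠ 0 := Nat.card_pos.ne'
  have hqeq : Nat.card (A₀ ⧸ S₀.addSubgroupOf A₀) = Nat.card (↥(endInvariants ψ) ⧸ φ.range) := by
    have h := hcardA
    rw [hlagA, hlagE, hS₀', hrange] at h
    exact Nat.eq_of_mul_eq_mul_right (Nat.pos_of_ne_zero hs0) h
  haveI := hfinQ
  have hq0 : Nat.card (A₀ ⧸ S₀.addSubgroupOf A₀) ≠ 0 := by rw [hqeq]; exact Nat.card_pos.ne'
  exact ⟨hfinS₀, Nat.finite_of_card_ne_zero hq0, by rw [hqeq]; exact heq⟩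

end Selmer

end SubSelmerControlZero

/-! ## §3 The instance for Kobayashi's STRICT signed structure in `W`-coordinates -/

namespace StrictSignedControlZero

variable {K : Type u} [Field K] [NumberField K] (W : WeierstrassCurve K) {p : ℕ} [Fact p.Prime]
  (κ : ZpExtension K p) (E : Type u) [Field E] [Algebra K E] (ε : ℤˣ)

/-- **`ord_p #Sel^{ε,str}(E/K_0) + ord_p #(A₀ ⧸ Sel^{ε,str}(E/K_0)) = ord_p f(0)`** for p17's STRICT
signed structure: `D : StrictSignedSelmerDualData W κ E γ ε` with `X` f.g. torsion, `char = (f)`,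
`f(0) ≠ 0`, no finite `Λ`-submodule, `E(K_∞)[p^∞] = 0`, and
`A₀ = h₀⁻¹(Sel^{ε,str}(E/K_∞))` — the EXACT form of p17's
`StrictSignedControlZero.finite_and_padicValNat_card_layer_zero_le`. For `ε = −1`, `K = ℚ`,
`E = ℚ_[p]`: `Sel^{−,str}(E/ℚ_0)` is the `p`-strict Selmer group (p17's FILE 3), and with Kobayashi
Thm. 7.4 at `η` ((C1_η)) + Kitajima–Otsuki read on `D` this is the typed (C3_η) up to the count of
`A₀ ⧸ S₀` (the GLOBAL count (C): `= ν + ord_p Tam(W)`, x1b GEN 31 `C3ETA-TRANSVERSALITY-x1b.md` §4).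
[cite: Kobayashi2003, Lemma 9.1 (p. 25), §2 (p. 4)] [cite: GreenbergLNM1716, §3 Lemma 3.2, §4 Lemma 4.2 (p. 102)] -/
theorem finite_and_padicValNat_card_add_eq {γ : Field.absoluteGaloisGroup K}
    (hγ : κ.IsTopGenerator γ) (D : StrictSignedSelmerDualData W κ E γ ε)
    [Module.Finite (IwasawaAlgebra p) D.X] (hX : Module.IsTorsion (IwasawaAlgebra p) D.X)
    (hB : FixedPoints.addSubgroup κ.kerSubgroup (W.geomPrimaryTorsion p) = ⊥)
    (hnf : ∀ N : Submodule (IwasawaAlgebra p) D.X, Finite N → N = ⊥)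
    {f : IwasawaAlgebra p} (hf : D.charIdeal = Ideal.span {f})
    (h0 : PowerSeries.constantCoeff f ≠ 0) :
    Finite (strictSignedSelmerLayer W κ E ε 0) ∧
      Finite (↥((strictSignedSelmerInfty W κ E ε).comap (W.layerToInfty κ 0)) ⧸
        (strictSignedSelmerLayer W κ E ε 0).addSubgroupOf ((strictSignedSelmerInfty W κ E ε).comap (W.layerToInfty κ 0))) ∧
      (padicValNat p (Nat.card (strictSignedSelmerLayer W κ E ε 0)) : ℤ) +
          padicValNat p (Nat.card (↥((strictSignedSelmerInfty W κ E ε).comap (W.layerToInfty κ 0)) ⧸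
            (strictSignedSelmerLayer W κ E ε 0).addSubgroupOf
              ((strictSignedSelmerInfty W κ E ε).comap (W.layerToInfty κ 0)))) =
        ((PowerSeries.constantCoeff f : ℤ_[p]) : ℚ_[p]).valuation :=
  SubSelmerControlZero.finite_and_padicValNat_card_add_eq W hγ hB
    (coe_conjStrictSignedSelmerInfty_sub_one_apply W κ E ε γ) (isDualPair D hγ) hX hnf hf h0
    (strictSignedSelmerLayer W κ E ε 0) (map_layerToInfty_strictSignedSelmerLayer_le W κ E ε 0)

end StrictSignedControlZero

end Summit.BirchSwinnertonDyer.Rank1Residual.Additive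

end
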